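import Mathlib
import HarnessLib
import Summits.HubbardSuperconductivity.HubbardSuperconductivity.Theorems.KLProgrammeKLRegimeTorusL1SecondDifferences

/-!
# Route `KLProgramme` — engine support (route (L2)): the SPACE-ONLY corollary of the `ℓ²` master lemma — the `ℓ¹` norm of a character sum on
# `(ℤ/L)²` from sup, support and the second differences along the two axes

Cell `gate-hubbard-kl`, seat hubbard-kl-k3c2-p3; gen-4 ENGINE child stmt-HubbardSuperconductivity-19855 (`stub_engine_scale0`: k3c2-p1 g2's
01:16:00Z ask (b) «Σ_z ‖Ǩ_L(z)‖ ≤ C·(sup|K| + sup‖D²K‖) from second differences — a time-free corollary to cite»; also the positional `L¹` size of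
any smooth counterterm vertex).  `sum_norm_charSum_le_of_second_differences` lives on `(ℤ/P)¹ × (ℤ/L)²` with five directions; taking the trivial
time torus `P = 1` (its character is `1`, its difference direction is `0`) and the integer frame `v = (1, 0)` (so `v⊥ = (0,1)`, `|v| = 1`) gives

* **`sum_norm_charSum_space_le_of_second_differences`**: for `G : (ℤ/L)² → ℂ` with `‖G‖ ≤ A₀`, `#{G ≠ 0} ≤ N_s` and
  `‖Δ²_{e_i} G‖ ≤ A₀(4/(sL))²` (`i = 0, 1`, `s > 0`, `2R₀ < L`):
  `Σ_z ‖Σ_k χ_k(z) G(k)‖ ≤ √(4096·(4(2√2/s + 2)² + 16(1/s+1)²/(1 + sR₀))) · √(16·L²·N_s) · A₀`.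

For the normalised transform `Ǩ_L(z) = L⁻² Σ_k K(p_k) χ_k(z)` of a `C²` periodic `K` (all `L²` momenta in the support, `A₀ = sup|K|/L²`,
`s = (2/π)√(sup|K|/sup‖D²K‖)`), the right side is `C·(sup|K| + sup‖D²K‖)`-shaped, uniformly in `L`.  Everything is proved; no definitions,
no named facts. [folklore]

References: G. Benfatto, A. Giuliani, V. Mastropietro, Ann. Henri Poincaré 7 (2006) 809–898, §2.8 (2.81) (the `ℓ²` route, footnote ¹).
-/

noncomputable section

namespace Summit.HubbardSuperconductivity.HubbardSuperconductivity.Theorems.TorusFourierL2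

set_option linter.dupNamespace false -- summit = problem name (single-conjunct summit), D-0017

open Finset Complex Literature.Probability.LatticeModels
open scoped Real

section Space

variable {L : ℕ} [NeZero L]

/-- Iterated differences along `(0, d)` of a function of the second coordinate. [folklore] -/
theorem fwdDiff_iter_snd {A B E : Type*} [AddCommMonoid A] [AddCommMonoid B] [AddCommGroup E] (G : B → E) (d : B) (n : ℕ) (q : A × B) :
    ((fwdDiff ((0 : A), d))^[n] (fun q : A × B => G q.2)) q = ((fwdDiff d)^[n] G) q.2 := by
  rw [fwdDiff_iter_eq_sum_shift, fwdDiff_iter_eq_sum_shift]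
  refine sum_congr rfl fun k _ => ?_
  simp [Prod.snd_add, Prod.smul_mk]

/-- **The space-only `ℓ¹` bound from second differences along the axes.** [cite: BenfattoGiulianiMastropietro2006, §2.8 (2.81)] -/
theorem sum_norm_charSum_space_le_of_second_differences (G : TorusSite 2 L → ℂ) {s : ℝ} (hs : 0 < s)
    {R₀ : ℕ} (hR₀ : 2 * (R₀ : ℤ) < L) {A₀ : ℝ} (hA₀ : 0 ≤ A₀) {Ns : ℕ}
    (hsupp : (univ.filter fun k => G k ≠ 0).card ≤ Ns) (hsup : ∀ k, ‖G k‖ ≤ A₀)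
    (h₁ : ∀ k (i : Fin 2), ‖(fwdDiff (Pi.single i (1 : ZMod L) : TorusSite 2 L))^[2] G k‖ ≤ A₀ * (4 / (s * L)) ^ 2) :
    ∑ z : TorusSite 2 L, ‖∑ k : TorusSite 2 L, torusChar k z • G k‖ ≤
      Real.sqrt (4096 * (4 * (2 * Real.sqrt 2 / s + 2) ^ 2 + 16 * (1 / s + 1) ^ 2 / (1 + s * R₀))) *
        Real.sqrt (16 * (L : ℝ) ^ 2 * Ns) * A₀ := by
  classical
  -- lift to the product with the trivial time torus `(ℤ/1)¹`
  set G' : TorusSite 1 1 × TorusSite 2 L → ℂ := fun q => G q.2 with hG'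
  have hv : (![1, 0] : Fin 2 → ℤ) ≠ 0 := by
    intro h; have := congrFun h 0; simp at this
  have hR₀' : 2 * (|(![1, 0] : Fin 2 → ℤ) 0| + |(![1, 0] : Fin 2 → ℤ) 1|) * (R₀ : ℤ) < L := by simpa using hR₀
  -- support
  have hsupp' : (univ.filter fun q : TorusSite 1 1 × TorusSite 2 L => G' q ≠ 0).card ≤ Ns := by
    refine le_trans ?_ hsupp
    refine Finset.card_le_card_of_injOn Prod.snd (fun q hq => ?_) (fun q₁ hq₁ q₂ hq₂ h => ?_)
    · simp only [coe_filter, mem_univ, true_and, Set.mem_setOf_eq] at hq ⊢; exact hq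
    · exact Prod.ext (Subsingleton.elim _ _) h
  have hsup' : ∀ q, ‖G' q‖ ≤ A₀ := fun q => hsup q.2
  -- time direction: the step is `0` on the trivial torus
  have htime0 : (((fun _ : Fin 1 => (1 : ZMod 1)), (0 : TorusSite 2 L)) : TorusSite 1 1 × TorusSite 2 L) = ((0 : TorusSite 1 1), (0 : TorusSite 2 L)) :=
    Prod.ext (Subsingleton.elim _ _) rfl
  have h₀' : ∀ q, ‖(fwdDiff ((fun _ : Fin 1 => (1 : ZMod 1)), (0 : TorusSite 2 L)))^[2] G' q‖ ≤ A₀ * (4 / (1 * (1 : ℕ))) ^ 2 := by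
    intro q
    rw [htime0, fwdDiff_iter_snd G 0 2 q]
    have hz : ∀ g : TorusSite 2 L → ℂ, fwdDiff (0 : TorusSite 2 L) g = 0 := fun g => by funext y; simp [fwdDiff]
    rw [Function.iterate_succ_apply', hz, Pi.zero_apply, norm_zero]
    positivity
  -- space directions
  have hdir2 : (fun j => ((![-(![1, 0] : Fin 2 → ℤ) 1, (![1, 0] : Fin 2 → ℤ) 0] j : ℤ) : ZMod L)) = (Pi.single 1 (1 : ZMod L) : TorusSite 2 L) := by
    funext j; fin_cases j <;> simp
  have hdir3 : (fun j => (((![1, 0] : Fin 2 → ℤ) j : ℤ) : ZMod L)) = (Pi.single 0 (1 : ZMod L) : TorusSite 2 L) := by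
    funext j; fin_cases j <;> simp
  have h₁' : ∀ q (i : Fin 2), ‖(fwdDiff ((0 : TorusSite 1 1), (Pi.single i (1 : ZMod L) : TorusSite 2 L)))^[2] G' q‖ ≤
      A₀ * (4 / (s * L)) ^ 2 := fun q i => by rw [fwdDiff_iter_snd G _ 2 q]; exact h₁ q.2 i
  have h₂' : ∀ q, ‖(fwdDiff ((0 : TorusSite 1 1), (fun j => ((![-(![1, 0] : Fin 2 → ℤ) 1, (![1, 0] : Fin 2 → ℤ) 0] j : ℤ) : ZMod L))))^[2] G' q‖ ≤
      A₀ * (4 / (s * L)) ^ 2 := fun q => by rw [hdir2, fwdDiff_iter_snd G _ 2 q]; exact h₁ q.2 1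
  have h₃' : ∀ q, ‖(fwdDiff ((0 : TorusSite 1 1), (fun j => (((![1, 0] : Fin 2 → ℤ) j : ℤ) : ZMod L))))^[2] G' q‖ ≤
      A₀ * (4 / (s * L)) ^ 2 := fun q => by rw [hdir3, fwdDiff_iter_snd G _ 2 q]; exact h₁ q.2 0
  have hmain := sum_norm_charSum_le_of_second_differences G' (![1, 0]) hv one_pos hs hs hs hR₀' hA₀ hsupp' hsup' h₀' h₁' h₂' h₃'
  -- the left-hand side is the space sum
  have hLHS : ∑ z : TorusSite 1 1 × TorusSite 2 L, ‖∑ q : TorusSite 1 1 × TorusSite 2 L, (torusChar q.1 z.1 * torusChar q.2 z.2) • G' q‖ =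
      ∑ z : TorusSite 2 L, ‖∑ k : TorusSite 2 L, torusChar k z • G k‖ := by
    rw [Fintype.sum_prod_type, Fintype.sum_unique]
    refine sum_congr rfl fun z _ => ?_
    rw [Fintype.sum_prod_type, Fintype.sum_unique]
    congr 1
    refine sum_congr rfl fun k _ => ?_
    have h1 : (default : TorusSite 1 1) = 0 := Subsingleton.elim _ _
    simp [hG', h1]
  rw [hLHS] at hmain
  refine hmain.trans (le_of_eq ?_)
  have hsq : Real.sqrt ((((![1, 0] : Fin 2 → ℤ) 0 : ℤ) : ℝ) ^ 2 + (((![1, 0] : Fin 2 → ℤ) 1 : ℤ) : ℝ) ^ 2) = 1 := by simp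
  rw [hsq]
  congr 2
  · congr 1; ring
  · norm_num

end Space

end Summit.HubbardSuperconductivity.HubbardSuperconductivity.Theorems.TorusFourierL2

end
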